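import Literature.Analysis.OperatorTheory.NelsonInteriorEstimate
import Literature.Analysis.OperatorTheory.NelsonCutoffWeights
import Literature.Analysis.OperatorTheory.FrameSobolevBound
import Literature.NumberTheory.Automorphic.StarFormallyRealTrace
import Literature.NumberTheory.Automorphic.AutomorphicFormsEllipticAnnihilator
import Literature.NumberTheory.Automorphic.ArchimedeanEnvelopingActionRegular
import HarnessLib

/-!
# Borel–Jacquet 4.3: the space of automorphic forms is `(𝔤, K_∞) × G(𝔸_f)`-stable
# (discharge of `automorphicForms_isStableSubmodule` for `ℝ`-linear involutions)

Topic `NumberTheory/Automorphic`; sibling proof file of `AutomorphicForms` on the named fact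
`automorphicForms_isStableSubmodule 𝒟` (Borel–Jacquet 1979, 4.3). The tree reduces the fact to the
moderate growth of the Lie derivatives `X φ` of automorphic forms
(`automorphicForms_isStableSubmodule_of_hasModerateGrowth_lieDeriv`, `ArchimedeanEnvelopingActionRegular`);
in print this is Harish-Chandra's lemma (HC 1966, §8; Borel 1997, 2.14 / 5.6) via `φ = φ ∗ α`.
This file PROVES that moderate growth by interior elliptic regularity in E. Nelson's `L²` form
(Ann. of Math. 70 (1959), §§6–8), assembled from sorry-free tree results:

* the elliptic annihilator `∑ⱼ rⱼ L_B^j φ = 0`, `r_M = 1`, `L_B = ∑ᵢ Bᵢ²` for an adapted basis `B`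
  of `𝔤` (`IsAutomorphicForm.exists_elliptic_annihilator`, `AutomorphicFormsEllipticAnnihilator`),
  fed with the positive trace of `StarFormallyRealTrace`;
* the exponential chart and its fields (`exists_chartFields`, `ArchimedeanExpChart`), complexified
  here (`fderiv_chartFun_chartField`, `vfWord_chartFun_eqOn`, `coe_laplacianEnd_pow_apply`);
* the geometric cut-off weights, their monotonicity / skew-adjointness / size
  (`Literature.Analysis.OperatorTheory.NelsonCutoffWeights`), the abstract interior estimate
  `sum_norm_weight_wordEnd_le_interiorConst` (`NelsonInteriorEstimate`) and the frame Sobolev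
  bound `exists_frame_pointBound` (`FrameSobolevBound`).

Main results:

* `HasModerateGrowth.lieDeriv_of_isRegular` — **for a regular datum over a finite-dimensional
  coefficient algebra with `ℝ`-linear involution, every `X φ` (`φ` automorphic, `X ∈ 𝔤`) has
  moderate growth**, with the exponent of `φ`;
* `automorphicForms_isStableSubmodule_holds_of_starModule` — **the named fact
  `automorphicForms_isStableSubmodule 𝒟` holds under `[StarModule ℝ A]`**;
* `isStableSubmodule_automorphicForms_of_isRegular` — the corrected statement (the involution
  `ℝ`-linear, as in the source where `A = K ⊗_ℚ ℝ`), as a theorem. The fact as originally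
  vendored quantified over arbitrary `StarRing` structures; conjugating complex conjugation by a
  wild automorphism of `ℂ` gives a star-formally-real, non-`ℝ`-linear involution for which `K_∞`
  is not compact and no published argument applies — the hypothesis was missing from the formal
  statement, not from Borel–Jacquet;
* `automorphicForms_isStableSubmodule_holds` — **the discharge of the named fact**, which since
  its restatement of 2026-08-15 carries `[StarModule ℝ A]` as its own (last) binder, so that it
  holds for every automorphy datum.

There are no definitions and no named facts in this file.

## References

* A. Borel, H. Jacquet, *Automorphic forms and automorphic representations*, Proc. Sympos. Pure
  Math. 33.1 (1979), 4.3 [BorelJacquetCorvallis1979].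
* Harish-Chandra, *Discrete series for semisimple Lie groups II*, Acta Math. 116 (1966), §8
  [HarishChandra1966].
* A. Borel, *Automorphic forms on `SL₂(ℝ)`* (1997), 2.14, 5.6 [Borel1997].
* E. Nelson, *Analytic vectors*, Ann. of Math. 70 (1959), §§6–8 [Nelson1959] (not held).
-/

-- Mathlib idiom (Mathlib/Algebra/Lie/OfAssociative.lean); needed to mention Lie subalgebras of matrix algebras
attribute [local instance 100] LieRing.ofAssociativeRing

noncomputable section

open scoped MatrixGroups Matrix ContDiff Topology InnerProductSpace ENNReal
open Filter Set MeasureTheory Metric Literature.Analysis.OperatorTheory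
  Literature.Analysis.Distribution

namespace Literature.NumberTheory.Automorphic

/-! ## 1. Three generic lemmas -/

section Generic

variable {κ : Type*} {V : Type*} [AddCommGroup V] [Module ℂ V]

/-- Words applied to a combination of first letters: `A_l (∑_p c_p A_p f) = ∑_p c_p A_{l ++ [p]} f`.
[folklore] -/
theorem wordEnd_apply_sum_smul [Fintype κ] (A : κ → Module.End ℂ V) (l : List κ) (c : κ → ℂ) (f : V) :
    wordEnd A l (∑ p, c p • A p f) = ∑ p, c p • wordEnd A (l ++ [p]) f := by
  rw [map_sum]
  refine Finset.sum_congr rfl fun p _ ↦ ?_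
  rw [map_smul, wordEnd_append, wordEnd_singleton, Module.End.mul_apply]

/-- Summing over words of length `k` and a last letter is summing over words of length `k + 1`.
[folklore] -/
theorem sum_sum_snoc_eq [Fintype κ] {k : ℕ} (g : (Fin (k + 1) → κ) → ℝ) :
    ∑ w : Fin k → κ, ∑ p : κ, g (Fin.snoc w p) = ∑ w' : Fin (k + 1) → κ, g w' := by
  rw [← Fintype.sum_equiv (Fin.snocEquiv fun _ : Fin (k + 1) ↦ κ)
    (fun q : κ × (Fin k → κ) ↦ g (Fin.snoc q.2 q.1)) g (fun _ ↦ rfl), Fintype.sum_prod_type,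
    Finset.sum_comm]

variable {d : ℕ}

/-- **The weight of level `0` dominates the `L²`-norm on a small ball**: if the closed ball of
radius `ϱ` lies in `{q ≤ S/2}` (where `χ_0 = 1`) then
`(∫_{‖x‖ ≤ ϱ} ‖P u‖²)^{1/2} ≤ ‖M_0 u‖`. [folklore] -/
theorem rpow_setIntegral_le_norm_weightMap {S : ℝ} (hS : 0 < S) (P : V →ₗ[ℂ] ((Fin d → ℝ) → ℂ))
    (hP : ∀ u, Continuous (P u)) {ϱ : ℝ}
    (hϱ : closedBall (0 : Fin d → ℝ) ϱ ⊆ {x | radSq x ≤ S / 2}) (u : V) :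
    (∫ x in closedBall (0 : Fin d → ℝ) ϱ, ‖P u x‖ ^ (2 : ℝ)) ^ (1 / 2 : ℝ) ≤ ‖weightMap hS P hP 0 u‖ := by
  rw [norm_weightMap_eq]
  have hint : Integrable (fun x ↦ ‖Literature.Analysis.OperatorTheory.weightFun S 0 (P u) x‖ ^ (2 : ℝ)) volume := by
    have := (memLp_weightFun hS 0 (hP u)).integrable_norm_rpow (by norm_num) (by norm_num)
    simpa using this
  refine Real.rpow_le_rpow (integral_nonneg fun x ↦ by positivity) ?_ (by norm_num)
  calc ∫ x in closedBall (0 : Fin d → ℝ) ϱ, ‖P u x‖ ^ (2 : ℝ)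
      ≤ ∫ x in closedBall (0 : Fin d → ℝ) ϱ, ‖Literature.Analysis.OperatorTheory.weightFun S 0 (P u) x‖ ^ (2 : ℝ) := by
        refine setIntegral_mono_on ?_ hint.integrableOn measurableSet_closedBall fun x hx ↦ ?_
        · exact (((hP u).norm.rpow_const fun _ ↦ Or.inr (by norm_num)).continuousOn).integrableOn_compact
            (isCompact_closedBall _ _)
        · exact Real.rpow_le_rpow (norm_nonneg _) (norm_le_norm_weightFun_zero hS (P u) (hϱ hx)) (by norm_num)
    _ ≤ ∫ x, ‖Literature.Analysis.OperatorTheory.weightFun S 0 (P u) x‖ ^ (2 : ℝ) :=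
        setIntegral_le_integral hint (Eventually.of_forall fun x ↦ by
          simp only [Pi.zero_apply]; positivity)

end Generic

/-! ## 2. Exponential charts: complex derivatives along the chart fields, words, Laplacians -/

section Chart

variable {A : Type*} [NormedCommRing A] [NormedAlgebra ℝ A] [NormedAlgebra ℚ A] [CompleteSpace A]
  [StarRing A] {N : Type*} [Fintype N] [DecidableEq N] {H : RealMatrixGroup A N}
  {G : Type*} [Group G] {ι : H.carrier →* G} {d : ℕ} [FiniteDimensional ℝ A]

/-- **The chart fields differentiate complex functions along the basis vectors**: the output of
`exists_chartFields` (stated for real parts `ℓ ∘ chartFun`) gives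
`D(chartFun ι B ψ g)(t)[Ξᵢ(t)] = (Bᵢ ψ)(g ι(chartExp B t))` for `t ∈ Ω₀` (apply it to `ℓ = re, im`).
[folklore] -/
theorem fderiv_chartFun_chartField {B : Module.Basis (Fin d) ℝ H.lie.toSubmodule}
    {Ξ : Fin d → (Fin d → ℝ) → (Fin d → ℝ)} {Ω₀ : Set (Fin d → ℝ)}
    (hΞ : ∀ (ψ : G → ℂ), IsArchSmooth ι ψ → ∀ (ℓ : ℂ →L[ℝ] ℝ) (g : G) (i : Fin d), ∀ t ∈ Ω₀,
      fieldDeriv (Ξ i) (fun t ↦ ℓ (chartFun ι B ψ g t)) t =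
        ℓ (lieDeriv ι (basisLie B i) ψ (g * ι (chartExp B t))))
    {ψ : G → ℂ} (hψ : IsArchSmooth ι ψ) (g : G) (i : Fin d) {t : Fin d → ℝ} (ht : t ∈ Ω₀) :
    fderiv ℝ (chartFun ι B ψ g) t (Ξ i t) = lieDeriv ι (basisLie B i) ψ (g * ι (chartExp B t)) := by
  have hF : DifferentiableAt ℝ (chartFun ι B ψ g) t :=
    (contDiff_chartFun B hψ g).differentiable (by simp) t
  have key : ∀ ℓ : ℂ →L[ℝ] ℝ, ℓ (fderiv ℝ (chartFun ι B ψ g) t (Ξ i t)) =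
      ℓ (lieDeriv ι (basisLie B i) ψ (g * ι (chartExp B t))) := by
    intro ℓ
    have h1 := hΞ ψ hψ ℓ g i t ht
    change fderiv ℝ (fun t ↦ ℓ (chartFun ι B ψ g t)) t (Ξ i t) = _ at h1
    rw [show (fun t ↦ ℓ (chartFun ι B ψ g t)) = ℓ ∘ chartFun ι B ψ g from rfl,
      fderiv_comp t ℓ.differentiableAt hF, ℓ.fderiv] at h1
    exact h1
  apply Complex.ext
  · simpa using key Complex.reCLM
  · simpa using key Complex.imCLM

/-- **Frame words of chart expressions are chart expressions of operator words**: if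
`ρ : 𝔤 → End (archSmooth ι)` acts by Lie derivatives then
`V_{i₁} ⋯ V_{i_k} (chartFun ι B v g) = chartFun ι B (A_{i₁} ⋯ A_{i_k} v) g` on `Ω₀`, `A_i = ρ(B_i)`.
[folklore] -/
theorem vfWord_chartFun_eqOn {B : Module.Basis (Fin d) ℝ H.lie.toSubmodule}
    {Ξ : Fin d → (Fin d → ℝ) → (Fin d → ℝ)} {Ω₀ : Set (Fin d → ℝ)} (hΩ₀ : IsOpen Ω₀)
    (hΞ : ∀ (ψ : G → ℂ), IsArchSmooth ι ψ → ∀ (ℓ : ℂ →L[ℝ] ℝ) (g : G) (i : Fin d), ∀ t ∈ Ω₀,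
      fieldDeriv (Ξ i) (fun t ↦ ℓ (chartFun ι B ψ g t)) t =
        ℓ (lieDeriv ι (basisLie B i) ψ (g * ι (chartExp B t))))
    (ρ : H.lie →ₗ⁅ℝ⁆ Module.End ℂ (archSmooth ι))
    (hρ : ∀ (X : H.lie) (ψ : archSmooth ι), ((ρ X ψ : archSmooth ι) : G → ℂ) = lieDeriv ι X ψ)
    (g : G) (l : List (Fin d)) (v : archSmooth ι) :
    EqOn (vfWord Ξ l (chartFun ι B (v : G → ℂ) g))
      (chartFun ι B ((wordEnd (fun i ↦ ρ (basisLie B i)) l v : archSmooth ι) : G → ℂ) g) Ω₀ := by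
  induction l with
  | nil => intro t _; simp [vfWord]
  | cons i l ih =>
    intro t ht
    have hev : vfWord Ξ l (chartFun ι B (v : G → ℂ) g) =ᶠ[𝓝 t]
        chartFun ι B ((wordEnd (fun i ↦ ρ (basisLie B i)) l v : archSmooth ι) : G → ℂ) g :=
      Filter.eventually_of_mem (hΩ₀.mem_nhds ht) fun y hy ↦ ih hy
    have hsm : IsArchSmooth ι ((wordEnd (fun i ↦ ρ (basisLie B i)) l v : archSmooth ι) : G → ℂ) :=
      (mem_archSmooth_iff ι _).1 (wordEnd (fun i ↦ ρ (basisLie B i)) l v).2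
    rw [vfWord_cons]
    change fderiv ℝ (vfWord Ξ l (chartFun ι B (↑v) g)) t (Ξ i t) = _
    rw [hev.fderiv_eq, fderiv_chartFun_chartField hΞ hsm g i ht, wordEnd_cons, Module.End.mul_apply,
      chartFun_apply, hρ]

omit [FiniteDimensional ℝ A] in
/-- **Powers of Nelson's Laplacian are the iterates of the sum-of-squares operator**:
`(∑ᵢ ρ(cᵢ)²)^j v = L_c^{∘ j} v` as functions. [folklore] -/
theorem coe_laplacianEnd_pow_apply {κ : Type*} [Fintype κ]
    (ρ : H.lie →ₗ⁅ℝ⁆ Module.End ℂ (archSmooth ι))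
    (hρ : ∀ (X : H.lie) (ψ : archSmooth ι), ((ρ X ψ : archSmooth ι) : G → ℂ) = lieDeriv ι X ψ)
    (c : κ → H.lie) (j : ℕ) (v : archSmooth ι) :
    (((laplacianEnd (fun i ↦ ρ (c i)) ^ j) v : archSmooth ι) : G → ℂ) = (sqSumOp ι c)^[j] (v : G → ℂ) := by
  induction j generalizing v with
  | zero => simp
  | succ j ih =>
    rw [pow_succ, Module.End.mul_apply, ih, Function.iterate_succ, Function.comp_apply]
    congr 1
    funext x
    rw [laplacianEnd_apply, sqSumOp_apply, Submodule.coe_sum, Finset.sum_apply]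
    refine Finset.sum_congr rfl fun i _ ↦ ?_
    rw [hρ, hρ]

end Chart


/-! ## 3. Moderate growth of the Lie derivatives of an automorphic form -/

section Main

variable {K : Type} [Field K] [NumberField K]
  {A : Type*} [NormedCommRing A] [NormedAlgebra ℝ A] [NormedAlgebra ℚ A] [CompleteSpace A]
  [StarRing A] {N : Type*} [Fintype N] [DecidableEq N]
  {𝒢 : AdelicGroupData K} {𝒟 : AutomorphyDatum 𝒢 A N}

/-- `ℝ`-scalars act on `End_ℂ` of a space of functions through `ℂ`. [folklore] -/
theorem real_smul_end_eq_coe_smul {G : Type*} [Group G] {H : RealMatrixGroup A N} {ι : H.carrier →* G}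
    (a : ℝ) (T : Module.End ℂ (archSmooth ι)) : a • T = (a : ℂ) • T := by
  refine LinearMap.ext fun v ↦ Subtype.ext ?_
  change a • ((T v : archSmooth ι) : G → ℂ) = (a : ℂ) • ((T v : archSmooth ι) : G → ℂ)
  exact real_smul_fun_eq_coe_smul a _

set_option maxHeartbeats 1600000 in
/-- **Harish-Chandra's growth lemma for a regular datum** (Borel–Jacquet 1979, 4.3 (ii);
Harish-Chandra 1966, Lemma 13; Borel 1997, 2.14/5.6): for a regular automorphy datum over a
finite-dimensional coefficient algebra with `ℝ`-linear involution and an automorphic form `φ`,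
every Lie derivative `X φ`, `X ∈ 𝔤`, has moderate growth (with the exponent of `φ`).

Proof (interior elliptic regularity in Nelson's form, no Fourier analysis): `φ` is killed by a
real monic polynomial in the sum of squares `L_B` of an adapted basis `B` of `𝔤`
(`IsAutomorphicForm.exists_elliptic_annihilator`, with the positive trace of
`StarFormallyRealTrace`); in the exponential chart `t ↦ y exp(∑ tᵢBᵢ)` at a base point `y`
(`ArchimedeanExpChart`) the Lie derivatives become vector fields (`fderiv_chartFun_chartField`),
the geometric cut-off weights of `NelsonCutoffWeights` satisfy the hypotheses of the abstract
interior estimate `sum_norm_weight_wordEnd_le_interiorConst` of `NelsonInteriorEstimate`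
uniformly in `y`, with size `a_y ≤ C (1 ⊔ ‖y‖)^r` by the moderate growth of `φ` and the height
axiom on the compact chart image; the estimate bounds the weighted `L²`-norms of all words of
length `≤ d + 1` in the `Bᵢ` applied to `φ`, and the frame Sobolev bound `exists_frame_pointBound`
of `FrameSobolevBound` turns them into the pointwise bound `|(X φ)(y)| ≤ C' (1 ⊔ ‖y‖)^r`.
[cite: BorelJacquetCorvallis1979, 4.3 (ii)] -/
theorem HasModerateGrowth.lieDeriv_of_isRegular [FiniteDimensional ℝ A] [StarModule ℝ A]
    (h𝒟 : 𝒟.IsRegular) {φ : 𝒢.Adelic → ℂ} (hφ : IsAutomorphicForm 𝒟 φ) (X : 𝒟.arch.lie) :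
    HasModerateGrowth 𝒟 (lieDeriv 𝒟.ofArch X φ) := by
  classical
  -- `star` is `ℝ`-linear on the finite-dimensional `A`, hence continuous
  haveI : ContinuousStar A := by
    refine ⟨?_⟩
    let σ : A →ₗ[ℝ] A :=
      { toFun := star
        map_add' := star_add
        map_smul' := fun r a ↦ by rw [star_smul, star_trivial]; rfl }
    exact σ.continuous_of_finiteDimensional
  /- Step 1: the elliptic annihilator `∑ⱼ rⱼ L_B^j φ = 0`, `r_M = 1` -/
  have htr : ∀ a : A, Algebra.trace ℝ A (star a) = Algebra.trace ℝ A a := trace_star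
  have hpos : ∀ a : A, a ≠ 0 → 0 < Algebra.trace ℝ A (star a * a) := fun a ha ↦ by
    rw [mul_comm]; exact h𝒟.isStarFormallyReal.trace_mul_star_self_pos ha
  obtain ⟨d, B, Mdeg, r, hrM, hann⟩ := hφ.exists_elliptic_annihilator h𝒟 htr hpos
  /- Step 2: the exponential chart of `B` and its fields -/
  obtain ⟨Ξ, Ω₀, hΞs, hΞ0, hΩ₀, h0Ω₀, hΞ⟩ :=
    exists_chartFields (ι := 𝒟.ofArch) h𝒟.mem_lie_of_expGL_mem B
  obtain ⟨R₀, hR₀, hballΩ⟩ := Metric.isOpen_iff.1 hΩ₀ 0 h0Ω₀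
  /- Step 3: the Lie algebra representation on smooth functions and Nelson's family -/
  obtain ⟨ρ, hρ⟩ := exists_lieHom_lieDeriv (𝒟.ofArch)
  set Aop : Fin d → Module.End ℂ (archSmooth 𝒟.ofArch) := fun i ↦ ρ (basisLie B i)
  -- structure constants of `𝔤` in the basis `B`
  set eqv := lieEquivSubmodule 𝒟.arch
  set cst : Fin d → Fin d → Fin d → ℝ := fun i m l ↦
    B.repr (eqv ⁅basisLie B i, basisLie B m⁆) l
  have hbasis : ∀ Y : 𝒟.arch.lie, Y = ∑ l, (B.repr (eqv Y) l) • basisLie B l := by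
    intro Y
    have h1 : eqv Y = ∑ l, (B.repr (eqv Y) l) • B l := (B.sum_repr (eqv Y)).symm
    have h2 : Y = eqv.symm (eqv Y) := (eqv.symm_apply_apply Y).symm
    conv_lhs => rw [h2, h1, map_sum]
    refine Finset.sum_congr rfl fun l _ ↦ ?_
    rw [map_smul]
    congr 1
  have hbr : ∀ i m, Aop i * Aop m - Aop m * Aop i = ∑ l, (cst i m l : ℂ) • Aop l := by
    intro i m
    have h1 : ρ (basisLie B i) * ρ (basisLie B m) - ρ (basisLie B m) * ρ (basisLie B i) =
        ρ ⁅basisLie B i, basisLie B m⁆ := by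
      rw [LieHom.map_lie, LieRing.of_associative_ring_bracket]
    change ρ (basisLie B i) * ρ (basisLie B m) - ρ (basisLie B m) * ρ (basisLie B i) =
      ∑ l, (cst i m l : ℂ) • ρ (basisLie B l)
    rw [h1]
    conv_lhs => rw [hbasis ⁅basisLie B i, basisLie B m⁆]
    rw [map_sum]
    refine Finset.sum_congr rfl fun l _ ↦ ?_
    rw [map_smul, real_smul_end_eq_coe_smul]
  set cM : ℝ := ∑ i, ∑ m, ∑ l, |cst i m l|
  have hcM0 : 0 ≤ cM := Finset.sum_nonneg fun _ _ ↦ Finset.sum_nonneg fun _ _ ↦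
    Finset.sum_nonneg fun _ _ ↦ abs_nonneg _
  have hc : ∀ i m l, |cst i m l| ≤ cM := by
    intro i m l
    calc |cst i m l| ≤ ∑ l', |cst i m l'| :=
          Finset.single_le_sum (f := fun l' ↦ |cst i m l'|) (fun _ _ ↦ abs_nonneg _) (Finset.mem_univ l)
      _ ≤ ∑ m', ∑ l', |cst i m' l'| :=
          Finset.single_le_sum (f := fun m' ↦ ∑ l', |cst i m' l'|)
            (fun _ _ ↦ Finset.sum_nonneg fun _ _ ↦ abs_nonneg _) (Finset.mem_univ m)
      _ ≤ cM := Finset.single_le_sum (f := fun i' ↦ ∑ m', ∑ l', |cst i' m' l'|)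
            (fun _ _ ↦ Finset.sum_nonneg fun _ _ ↦ Finset.sum_nonneg fun _ _ ↦ abs_nonneg _)
            (Finset.mem_univ i)
  /- Step 4: chart expressions `P_y v = (t ↦ v (y ι(exp ∑ tᵢBᵢ)))` and their derivatives -/
  set P : 𝒢.Adelic → (archSmooth 𝒟.ofArch) →ₗ[ℂ] ((Fin d → ℝ) → ℂ) := fun y ↦
    { toFun := fun v ↦ chartFun 𝒟.ofArch B (v : 𝒢.Adelic → ℂ) y
      map_add' := fun v w ↦ rfl
      map_smul' := fun c v ↦ rfl }
  have hP_apply : ∀ y v t, P y v t = (v : 𝒢.Adelic → ℂ) (y * 𝒟.ofArch (chartExp B t)) := fun _ _ _ ↦ rfl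
  have hPs : ∀ y v, ContDiff ℝ ∞ (P y v) := fun y v ↦
    contDiff_chartFun B ((mem_archSmooth_iff _ _).1 v.2) y
  have hPA : ∀ y p v, EqOn (P y (Aop p v)) (fun x ↦ fderiv ℝ (P y v) x (Ξ p x)) (ball 0 R₀) := by
    intro y p v x hx
    change ((ρ (basisLie B p) v : archSmooth _) : 𝒢.Adelic → ℂ) (y * 𝒟.ofArch (chartExp B x)) =
      fderiv ℝ (chartFun 𝒟.ofArch B (v : 𝒢.Adelic → ℂ) y) x (Ξ p x)
    rw [hρ, fderiv_chartFun_chartField hΞ ((mem_archSmooth_iff _ _).1 v.2) y p (hballΩ hx)]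
  /- Step 5: the cut-off scale `S` and the weights -/
  set S : ℝ := min (R₀ ^ 2 / 2) 1
  have hS : 0 < S := lt_min (by positivity) one_pos
  have hSR : S < R₀ ^ 2 := (min_le_left _ _).trans_lt (by nlinarith)
  obtain ⟨D, hD0, hskew⟩ :=
    exists_skew_const Ξ hR₀.le (fun p ↦ (hΞs p).contDiffOn) hS hSR P hPs Aop hPA
  set Mw : 𝒢.Adelic → ℕ → (archSmooth 𝒟.ofArch) →ₗ[ℂ] Lp ℂ 2 (volume : Measure (Fin d → ℝ)) :=
    fun y m ↦ weightMap hS (P y) (fun v ↦ (hPs y v).continuous) m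
  /- Step 6: the relation `Δ^M f = -∑_{j<M} rⱼ Δ^j f` in `archSmooth` -/
  set f : archSmooth 𝒟.ofArch := ⟨φ, (mem_archSmooth_iff _ _).2 hφ.archSmooth⟩
  have hΔpow : ∀ j, (((laplacianEnd Aop ^ j) f : archSmooth _) : 𝒢.Adelic → ℂ) =
      (sqSumOp 𝒟.ofArch (basisLie B))^[j] φ := fun j ↦ coe_laplacianEnd_pow_apply ρ hρ (basisLie B) j f
  -- the degenerate case `M = 0`: then `φ = 0`
  by_cases hM0 : Mdeg = 0
  · subst hM0
    have hφ0 : φ = 0 := by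
      funext x
      have h := hann x
      rw [Finset.sum_range_one, hrM] at h
      simpa using h
    refine ⟨0, 0, fun g ↦ ?_⟩
    have : lieDeriv 𝒟.ofArch X φ = 0 := by
      funext g
      simp [lieDeriv, hφ0]
    rw [this]
    simp
  have hA₀ : 1 ≤ Mdeg := Nat.one_le_iff_ne_zero.2 hM0
  set rr : ℕ → ℂ := fun j ↦ -(r j : ℂ) with hrr
  have hR : (laplacianEnd Aop ^ Mdeg) f = ∑ i ∈ Finset.range Mdeg, rr i • (laplacianEnd Aop ^ i) f := by
    apply Subtype.ext
    rw [hΔpow, Submodule.coe_sum]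
    funext x
    rw [Finset.sum_apply]
    simp only [Submodule.coe_smul, Pi.smul_apply, smul_eq_mul, hΔpow, hrr]
    have h := hann x
    rw [Finset.sum_range_succ, hrM, Complex.ofReal_one, one_mul] at h
    rw [eq_neg_of_add_eq_zero_right h, ← Finset.sum_neg_distrib]
    refine Finset.sum_congr rfl fun j _ ↦ ?_
    ring
  set rM : ℝ := ∑ j ∈ Finset.range Mdeg, ‖(r j : ℂ)‖
  have hrM0 : 0 ≤ rM := Finset.sum_nonneg fun _ _ ↦ norm_nonneg _
  have hr : ∀ i < Mdeg, ‖rr i‖ ≤ rM := by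
    intro i hi
    rw [hrr]
    simp only [norm_neg]
    exact Finset.single_le_sum (f := fun j ↦ ‖(r j : ℂ)‖) (fun _ _ ↦ norm_nonneg _)
      (Finset.mem_range.2 hi)
  /- Step 7: the size of the weights of `f` at the base point `y`: moderate growth -/
  obtain ⟨Cφ, rexp, hCφ⟩ := hφ.moderateGrowth
  set Cφ' : ℝ := max Cφ 0
  have hCφ'0 : 0 ≤ Cφ' := le_max_right _ _
  have hgrowth : ∀ g, ‖φ g‖ ≤ Cφ' * (1 ⊔ 𝒟.height g) ^ rexp := fun g ↦
    (hCφ g).trans (mul_le_mul_of_nonneg_right (le_max_left _ _)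
      (pow_nonneg (le_trans zero_le_one le_sup_left) _))
  set sK : Set 𝒟.arch.carrier := chartExp B '' {x : Fin d → ℝ | radSq x ≤ 2 * S}
  have hsKc : IsCompact sK := (isCompact_setOf_radSq_le _).image (continuous_chartExp B)
  obtain ⟨CK, hCK⟩ := h𝒟.height_mul_ofArch_le sK hsKc
  set CK' : ℝ := max CK 0
  have hCK'0 : 0 ≤ CK' := le_max_right _ _
  have hCK'1 : ∀ x, radSq x ≤ 2 * S → ∀ y,
      1 ⊔ 𝒟.height (y * 𝒟.ofArch (chartExp B x)) ≤ CK' * (1 ⊔ 𝒟.height y) := fun x hx y ↦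
    (hCK _ ⟨x, hx, rfl⟩ y).trans
      (mul_le_mul_of_nonneg_right (le_max_left _ _) (le_trans zero_le_one le_sup_left))
  set Bnd : 𝒢.Adelic → ℝ := fun y ↦ Cφ' * (CK' * (1 ⊔ 𝒟.height y)) ^ rexp with hBnd
  have h1h : ∀ y : 𝒢.Adelic, (0 : ℝ) ≤ 1 ⊔ 𝒟.height y := fun y ↦ le_trans zero_le_one le_sup_left
  have hBnd0 : ∀ y, 0 ≤ Bnd y := fun y ↦
    mul_nonneg hCφ'0 (pow_nonneg (mul_nonneg hCK'0 (h1h y)) _)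
  have ha : ∀ y m, ‖Mw y m f‖ ≤ Bnd y * envelopeNorm (d := d) hS := by
    intro y m
    refine norm_weightMap_le_of_bound hS (P y) _ m f fun x hx ↦ ?_
    rw [hP_apply]
    change ‖φ (y * 𝒟.ofArch (chartExp B x))‖ ≤ Bnd y
    refine (hgrowth _).trans ?_
    exact mul_le_mul_of_nonneg_left (pow_le_pow_left₀ (h1h _) (hCK'1 x hx y) rexp) hCφ'0
  /- Step 8: the interior estimate, uniformly in `y` -/
  set Kint : ℝ := interiorConst d cM D Mdeg rM (d + 2)
  have hint : ∀ y, ∀ k ≤ d + 1, ∑ w : Fin k → Fin d, ‖Mw y 0 (wordEnd Aop (List.ofFn w) f)‖ ≤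
      Kint * (Bnd y * envelopeNorm (d := d) hS) := by
    intro y k hk
    have h := sum_norm_weight_wordEnd_le_interiorConst Aop cst hbr hcM0 hc (Mw y)
      (fun m v ↦ norm_weightMap_le_succ hS (P y) _ m v) hD0 (fun m i u w ↦ hskew y m i u w)
      (fun v ↦ exists_norm_weightMap_le hS (P y) _ v) hA₀ hrM0 hr hR (ha y)
      (kmax := d + 2) (by omega) (k := k) (by omega)
    rwa [Fintype.card_fin] at h
  /- Step 9: the Sobolev radius -/
  obtain ⟨ρ₀, hρ₀, hρ₀R, hSob⟩ := exists_frame_pointBound (Vf := Ξ) hR₀ (fun p ↦ (hΞs p).contDiffOn)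
    (isUnit_frameMap_zero hΞ0)
  set ϱ : ℝ := min ρ₀ (Real.sqrt (S / (2 * (d + 1))))
  have hϱ0 : 0 < ϱ := lt_min hρ₀ (Real.sqrt_pos.2 (by positivity))
  have hϱρ₀ : ϱ ≤ ρ₀ := min_le_left _ _
  obtain ⟨Csob, hCsob0, hCsob⟩ := hSob ϱ hϱ0 hϱρ₀
  have hϱS : closedBall (0 : Fin d → ℝ) ϱ ⊆ {x | radSq x ≤ S / 2} := by
    intro x hx
    rw [mem_closedBall, dist_zero_right] at hx
    have h1 : radSq x ≤ d * ‖x‖ ^ 2 := radSq_le x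
    have h2 : ‖x‖ ^ 2 ≤ ϱ ^ 2 := pow_le_pow_left₀ (norm_nonneg _) hx 2
    have h3 : ϱ ^ 2 ≤ S / (2 * (d + 1)) := by
      calc ϱ ^ 2 ≤ Real.sqrt (S / (2 * (d + 1))) ^ 2 :=
            pow_le_pow_left₀ hϱ0.le (min_le_right _ _) 2
        _ = S / (2 * (d + 1)) := Real.sq_sqrt (by positivity)
    have hd : (0 : ℝ) ≤ d := Nat.cast_nonneg d
    change radSq x ≤ S / 2
    calc radSq x ≤ d * ϱ ^ 2 := h1.trans (mul_le_mul_of_nonneg_left h2 hd)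
      _ ≤ d * (S / (2 * (d + 1))) := mul_le_mul_of_nonneg_left h3 hd
      _ ≤ ((d : ℝ) + 1) * (S / (2 * (d + 1))) :=
          mul_le_mul_of_nonneg_right (by linarith) (by positivity)
      _ = S / 2 := by field_simp
  have hϱΩ : closedBall (0 : Fin d → ℝ) ϱ ⊆ Ω₀ :=
    ((closedBall_subset_ball (hϱρ₀.trans_lt hρ₀R)).trans hballΩ)
  /- Step 10: the coordinates of `X` and the final bound -/
  set xc : Fin d → ℝ := fun p ↦ B.repr (eqv X) p
  set xM : ℝ := ∑ p, ‖(xc p : ℂ)‖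
  have hxM0 : 0 ≤ xM := Finset.sum_nonneg fun _ _ ↦ norm_nonneg _
  have hρX : ρ X f = ∑ p, (xc p : ℂ) • Aop p f := by
    conv_lhs => rw [hbasis X, map_sum, LinearMap.sum_apply]
    refine Finset.sum_congr rfl fun p _ ↦ ?_
    rw [map_smul, real_smul_end_eq_coe_smul, LinearMap.smul_apply]
  refine ⟨Csob * ((d + 1) * (xM * (Kint * (Cφ' * CK' ^ rexp * envelopeNorm (d := d) hS)))), rexp, fun y ↦ ?_⟩
  -- the chart expression of `X φ` at `y` and its value at `0`
  set F : (Fin d → ℝ) → ℂ := P y (ρ X f) with hF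
  have hF0 : F 0 = lieDeriv 𝒟.ofArch X φ y := by
    rw [hF, hP_apply, chartExp_zero, map_one, mul_one, hρ]
  have hFs : ContDiff ℝ ∞ F := hPs y _
  -- words of `F` in the chart are chart expressions of operator words
  have hword : ∀ (k : ℕ) (w : Fin k → Fin d),
      (∫ x in closedBall (0 : Fin d → ℝ) ϱ, ‖vfWord Ξ (List.ofFn w) F x‖ ^ (2 : ℝ)) ^ (1 / 2 : ℝ) ≤
        xM * ∑ p, ‖Mw y 0 (wordEnd Aop (List.ofFn (Fin.snoc w p : Fin (k + 1) → Fin d)) f)‖ := by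
    intro k w
    have heq : EqOn (vfWord Ξ (List.ofFn w) F)
        (P y (wordEnd Aop (List.ofFn w) (ρ X f))) (closedBall 0 ϱ) := fun x hx ↦
      vfWord_chartFun_eqOn hΩ₀ hΞ ρ hρ y (List.ofFn w) (ρ X f) (hϱΩ hx)
    rw [setIntegral_congr_fun measurableSet_closedBall (fun x hx ↦ by rw [heq hx])]
    refine (rpow_setIntegral_le_norm_weightMap hS (P y) (fun v ↦ (hPs y v).continuous) hϱS _).trans ?_
    change ‖Mw y 0 (wordEnd Aop (List.ofFn w) (ρ X f))‖ ≤ _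
    rw [hρX, wordEnd_apply_sum_smul, map_sum]
    refine (norm_sum_le _ _).trans ?_
    rw [Finset.mul_sum]
    refine Finset.sum_le_sum fun p _ ↦ ?_
    rw [map_smul, norm_smul, ← ofFn_snoc]
    refine mul_le_mul_of_nonneg_right ?_ (norm_nonneg _)
    exact Finset.single_le_sum (f := fun p ↦ ‖(xc p : ℂ)‖) (fun _ _ ↦ norm_nonneg _) (Finset.mem_univ p)
  -- assemble
  rw [← hF0]
  refine (hCsob F hFs).trans ?_
  have hk : ∀ k ∈ Finset.range (d + 1), ∑ w : Fin k → Fin d,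
      (∫ x in closedBall (0 : Fin d → ℝ) ϱ, ‖vfWord Ξ (List.ofFn w) F x‖ ^ (2 : ℝ)) ^ (1 / 2 : ℝ) ≤
        xM * (Kint * (Bnd y * envelopeNorm (d := d) hS)) := by
    intro k hk
    have hk' : k + 1 ≤ d + 1 := by have := Finset.mem_range.1 hk; omega
    calc ∑ w : Fin k → Fin d, (∫ x in closedBall (0 : Fin d → ℝ) ϱ, ‖vfWord Ξ (List.ofFn w) F x‖ ^ (2 : ℝ)) ^ (1 / 2 : ℝ)
        ≤ ∑ w : Fin k → Fin d, xM * ∑ p, ‖Mw y 0 (wordEnd Aop (List.ofFn (Fin.snoc w p : Fin (k + 1) → Fin d)) f)‖ :=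
          Finset.sum_le_sum fun w _ ↦ hword k w
      _ = xM * ∑ w' : Fin (k + 1) → Fin d, ‖Mw y 0 (wordEnd Aop (List.ofFn w') f)‖ := by
          have hsn := sum_sum_snoc_eq
            (fun w' : Fin (k + 1) → Fin d ↦ ‖Mw y 0 (wordEnd Aop (List.ofFn w') f)‖)
          rw [← Finset.mul_sum, hsn]
      _ ≤ xM * (Kint * (Bnd y * envelopeNorm (d := d) hS)) :=
          mul_le_mul_of_nonneg_left (hint y (k + 1) hk') hxM0
  calc Csob * ∑ k ∈ Finset.range (d + 1), ∑ w : Fin k → Fin d,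
        (∫ x in closedBall (0 : Fin d → ℝ) ϱ, ‖vfWord Ξ (List.ofFn w) F x‖ ^ (2 : ℝ)) ^ (1 / 2 : ℝ)
      ≤ Csob * ∑ _k ∈ Finset.range (d + 1), xM * (Kint * (Bnd y * envelopeNorm (d := d) hS)) :=
        mul_le_mul_of_nonneg_left (Finset.sum_le_sum hk) hCsob0
    _ = Csob * ((d + 1) * (xM * (Kint * (Cφ' * CK' ^ rexp * envelopeNorm (d := d) hS)))) *
          (1 ⊔ 𝒟.height y) ^ rexp := by
        rw [Finset.sum_const, Finset.card_range, nsmul_eq_mul]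
        simp only [hBnd, mul_pow]
        push_cast
        ring

/-- **Borel–Jacquet 1979, 4.3, for `ℝ`-linear involutions**: the space of automorphic forms of a
regular automorphy datum over a finite-dimensional coefficient algebra whose involution is
`ℝ`-linear is stable under `G(𝔸_f)`, `K_∞` and `𝔤` — the named fact
`automorphicForms_isStableSubmodule 𝒟` of `AutomorphicForms` under the instance hypothesis
`[StarModule ℝ A]` (automatic for `A = K ⊗_ℚ ℝ ≅ ℝ^{r₁} × ℂ^{r₂}` with its standard involution,
the setting of the source). [cite: BorelJacquetCorvallis1979, 4.3] -/
theorem automorphicForms_isStableSubmodule_holds_of_starModule [StarModule ℝ A] :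
    automorphicForms_isStableSubmodule 𝒟 := by
  -- tactic form: a term-mode proof trips the `overlappingInstances` linter on the outer
  -- `[StarModule ℝ A]` and the instance binder inside the named fact `automorphicForms_isStableSubmodule`
  exact automorphicForms_isStableSubmodule_of_hasModerateGrowth_lieDeriv fun h𝒟 _ hφ X ↦
    HasModerateGrowth.lieDeriv_of_isRegular h𝒟 hφ X

/-- **Borel–Jacquet 1979, 4.3 — corrected statement, proved.** The named fact
`automorphicForms_isStableSubmodule 𝒟` of `AutomorphicForms`, as originally vendored (before its
restatement of 2026-08-15, which added the binder `[StarModule ℝ A]`), quantified over ALL `StarRing`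
structures on the coefficient algebra `A` compatible with regularity; every published proof
(Harish-Chandra's `φ = φ ∗ α`, or elliptic regularity as here) uses that the involution is
`ℝ`-linear (then continuous, `A` being finite-dimensional), which holds in the source's setting
`A = K ⊗_ℚ ℝ` but is not implied by the hypotheses as formalised (conjugates of complex
conjugation by wild automorphisms of `ℂ` are star-formally-real, not `ℝ`-linear). This is the
statement WITH that hypothesis: for a regular datum over a finite-dimensional coefficient algebra
with `ℝ`-linear involution, `𝒜` is `(𝔤, K_∞) × G(𝔸_f)`-stable. [cite: BorelJacquetCorvallis1979, 4.3] -/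
theorem isStableSubmodule_automorphicForms_of_isRegular [FiniteDimensional ℝ A] [StarModule ℝ A]
    (h𝒟 : 𝒟.IsRegular) : IsStableSubmodule 𝒟 (automorphicForms 𝒟) :=
  automorphicForms_isStableSubmodule_holds_of_starModule h𝒟

/-- **Borel–Jacquet 1979, 4.3 — the named fact discharged.** The named fact
`automorphicForms_isStableSubmodule 𝒟` of `AutomorphicForms` (restated 2026-08-15 with the
source's standing hypothesis — the involution of the coefficient algebra is `ℝ`-linear,
`[StarModule ℝ A]`, automatic for `A = K ⊗_ℚ ℝ` — as its last binder) holds for EVERY automorphy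
datum: for a regular datum over a finite-dimensional coefficient algebra with `ℝ`-linear
involution the space of automorphic forms is `(𝔤, K_∞) × G(𝔸_f)`-stable
(`isStableSubmodule_automorphicForms_of_isRegular`: the group and `𝔨` parts are formal, the
moderate growth of `X φ` is interior elliptic regularity on the elliptic annihilator of a
`K_∞`-finite `Z(𝔤)`-finite form of moderate growth). Borel–Jacquet 1979, 4.3; Harish-Chandra
1966, §8, Lemma 13. [cite: BorelJacquetCorvallis1979, 4.3] -/
theorem automorphicForms_isStableSubmodule_holds : automorphicForms_isStableSubmodule 𝒟 :=
  fun h𝒟 _ ↦ isStableSubmodule_automorphicForms_of_isRegular h𝒟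

end Main

end Literature.NumberTheory.Automorphic
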